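import Summits.HubbardSuperconductivity.HubbardSuperconductivity.Theorems.AnisotropyChordTransferFibre3FinXDEval
import Summits.HubbardSuperconductivity.HubbardSuperconductivity.Theorems.AnisotropyChordTransferFibre3FinXB2Sound

/-!
# Route `AnisotropyChord` / H0 rotor rung: FIN per-`L` row-D evaluator XD — soundness layer 1a: lists, exact accumulations, rounding

Generic lemmas for the soundness of `…Fibre3FinXDEval` (prover seat `hubbard-h0-rotor-p3` g7): key-list lookups (`getIv_map_fidx`),
rotated / reflected table rows (`getIv_rotate`, `getIv_rowRefl`), the three-row exact accumulation (`dotP3_lower/upper`, cf. XB2's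
`dotP_lower/upper`), signed weights (`smulNN_sound`) and the outward roundings from scales `D²`, `D³` (`mem_roundP'`, `mem_round3`,
one-sided forms).  Helper for piece A = stmt-HubbardSuperconductivity-23918 of rung 19089 (`--supports`, helper class).
WHAT THIS IS NOT: nothing here proves superconductivity in the Hubbard model (rotor TARGET as worded stays FALSE, g15 verdict); evaluator
soundness for the FIN certificates of ONE conditional reduction.  Tree imports only; no sorry, no new axioms.
-/

set_option linter.dupNamespace false
set_option autoImplicit false

namespace Summit.HubbardSuperconductivity.HubbardSuperconductivity.Theorems.AnisotropyChord.Transfer.Fibre3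

namespace FinXD

open scoped BigOperators
open Finset Hole2 FinCell FinXB

/-! ## List lookups -/

/-- the index of a member is in range. [folklore] -/
theorem fidx_lt {α : Type} [DecidableEq α] {l : List α} {a : α} (ha : a ∈ l) : fidx l a < l.length := by
  unfold fidx
  exact List.findIdx_lt_length_of_exists ⟨a, ha, by simp⟩

/-- the element at the index of a member is that member. [folklore] -/
theorem getElem_fidx {α : Type} [DecidableEq α] {l : List α} {a : α} (ha : a ∈ l) :
    l[fidx l a]'(fidx_lt ha) = a := by
  have h := List.findIdx_getElem (p := fun x => decide (x = a)) (w := fidx_lt ha)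
  unfold fidx
  simpa using h

/-- lookup in a mapped key list by the key's index. [folklore] -/
theorem getD_map_fidx {α β : Type} [DecidableEq α] {l : List α} {a : α} (ha : a ∈ l) (F : α → β) (d : β) :
    (l.map F).getD (fidx l a) d = F a := by
  rw [List.getD_eq_getElem _ _ (by rw [List.length_map]; exact fidx_lt ha), List.getElem_map, getElem_fidx ha]

/-- interval lookup in a mapped key list. [folklore] -/
theorem getIv_map_fidx {α : Type} [DecidableEq α] {l : List α} {a : α} (ha : a ∈ l) (F : α → Iv) :
    getIv (l.map F) (fidx l a) = F a := getD_map_fidx ha F _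

/-- interval lookup in a `range`-built list. [folklore] -/
theorem getIv_map_range (F : ℕ → Iv) {n i : ℕ} (hi : i < n) : getIv ((List.range n).map F) i = F i :=
  getD_map_range F _ hi

/-! ## Rows: rotations and reflections -/

variable (L : ℕ)

/-- entry of a rotated row. [folklore] -/
theorem getIv_rotate (g : ℕ → Iv) (m : ℕ) {j : ℕ} (hj : j < L) :
    getIv (((List.range L).map g).rotate m) j = g ((j + m) % L) := by
  have hlen : (((List.range L).map g).rotate m).length = L := by
    rw [List.length_rotate, List.length_map, List.length_range]
  unfold getIv
  rw [List.getD_eq_getElem _ _ (by rw [hlen]; exact hj), List.getElem_rotate]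
  simp only [List.length_map, List.length_range, List.getElem_map, List.getElem_range]

/-- entry of the reflected row: `j ↦ g((q₂ − j) mod L)`. [folklore] -/
theorem getIv_rowRefl (g : ℕ → Iv) {q2 j : ℕ} (hq2 : q2 < L) (hj : j < L) :
    getIv (rowRefl L ((List.range L).map g) q2) j = g ((q2 + L - j) % L) := by
  have hL : 0 < L := by omega
  have hlenr : (((List.range L).map g).rotate ((q2 + 1) % L)).length = L := by
    rw [List.length_rotate, List.length_map, List.length_range]
  have hlen : (rowRefl L ((List.range L).map g) q2).length = L := by
    unfold rowRefl; rw [List.length_reverse, hlenr]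
  unfold getIv
  rw [List.getD_eq_getElem _ _ (by rw [hlen]; exact hj)]
  unfold rowRefl
  rw [List.getElem_reverse, List.getElem_rotate]
  simp only [List.length_rotate, List.length_map, List.length_range, List.getElem_map, List.getElem_range]
  congr 1
  -- `(L - 1 - j + (q2 + 1) % L) % L = (q2 + L - j) % L`
  rcases Nat.lt_or_ge (q2 + 1) L with h | h
  · rw [Nat.mod_eq_of_lt h]
    congr 1
    omega
  · have hq : q2 + 1 = L := by omega
    rw [hq, Nat.mod_self, Nat.add_zero]
    have e : q2 + L - j = (L - 1 - j) + L := by omega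
    rw [e, Nat.add_mod_right]

/-- length of the reflected row. [folklore] -/
theorem length_rowRefl (r : List Iv) (q2 : ℕ) : (rowRefl L r q2).length = r.length := by
  unfold rowRefl; rw [List.length_reverse, List.length_rotate]

/-! ## Exact accumulation of three rows -/

/-- lower bound of the three-row accumulation (nonnegative lower ends below `x·D`, `y·D`, `z·D`). [folklore] -/
theorem dotP3_lower : ∀ (l1 l2 l3 : List Iv) (x y z : ℕ → ℝ) (acc : ℤ × ℤ), l1.length = l2.length → l1.length = l3.length →
    (∀ j : ℕ, j < l1.length → 0 ≤ (((getIv l1 j).1 : ℤ) : ℝ) ∧ (((getIv l1 j).1 : ℤ) : ℝ) ≤ x j * ((D : ℤ) : ℝ)) →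
    (∀ j : ℕ, j < l2.length → 0 ≤ (((getIv l2 j).1 : ℤ) : ℝ) ∧ (((getIv l2 j).1 : ℤ) : ℝ) ≤ y j * ((D : ℤ) : ℝ)) →
    (∀ j : ℕ, j < l3.length → 0 ≤ (((getIv l3 j).1 : ℤ) : ℝ) ∧ (((getIv l3 j).1 : ℤ) : ℝ) ≤ z j * ((D : ℤ) : ℝ)) →
    (((dotP3 l1 l2 l3 acc).1 : ℤ) : ℝ)
      ≤ (acc.1 : ℝ) + (∑ j ∈ range l1.length, x j * y j * z j) * ((D : ℤ) : ℝ) * ((D : ℤ) : ℝ) * ((D : ℤ) : ℝ)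
  | [], [], [], x, y, z, acc, _, _, _, _, _ => by simp [dotP3]
  | [], _ :: _, _, x, y, z, acc, h12, _, _, _, _ => by simp at h12
  | _ :: _, [], _, x, y, z, acc, h12, _, _, _, _ => by simp at h12
  | [], [], _ :: _, x, y, z, acc, _, h13, _, _, _ => by simp at h13
  | _ :: _, _ :: _, [], x, y, z, acc, _, h13, _, _, _ => by simp at h13
  | a :: as, b :: bs, c :: cs, x, y, z, acc, h12, h13, hx, hy, hz => by
      simp only [List.length_cons] at h12 h13 hx hy hz ⊢
      rw [Finset.sum_range_succ', dotP3]
      have h0x := hx 0 (by omega)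
      have h0y := hy 0 (by omega)
      have h0z := hz 0 (by omega)
      simp only [getIv, List.getD_cons_zero] at h0x h0y h0z
      have ih := dotP3_lower as bs cs (fun j => x (j + 1)) (fun j => y (j + 1)) (fun j => z (j + 1))
        (acc.1 + a.1 * b.1 * c.1, acc.2 + a.2 * b.2 * c.2) (by omega) (by omega)
        (fun j hj => by simpa only [getIv, List.getD_cons_succ] using hx (j + 1) (by omega))
        (fun j hj => by simpa only [getIv, List.getD_cons_succ] using hy (j + 1) (by omega))
        (fun j hj => by simpa only [getIv, List.getD_cons_succ] using hz (j + 1) (by omega))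
      have hab : ((a.1 : ℤ) : ℝ) * ((b.1 : ℤ) : ℝ) ≤ x 0 * ((D : ℤ) : ℝ) * (y 0 * ((D : ℤ) : ℝ)) :=
        mul_le_mul h0x.2 h0y.2 h0y.1 (h0x.1.trans h0x.2)
      have hab0 : 0 ≤ ((a.1 : ℤ) : ℝ) * ((b.1 : ℤ) : ℝ) := mul_nonneg h0x.1 h0y.1
      have habc : ((a.1 : ℤ) : ℝ) * ((b.1 : ℤ) : ℝ) * ((c.1 : ℤ) : ℝ)
          ≤ x 0 * ((D : ℤ) : ℝ) * (y 0 * ((D : ℤ) : ℝ)) * (z 0 * ((D : ℤ) : ℝ)) :=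
        mul_le_mul hab h0z.2 h0z.1 (hab0.trans hab)
      push_cast at ih ⊢
      nlinarith [ih, habc]

/-- upper bound of the three-row accumulation. [folklore] -/
theorem dotP3_upper : ∀ (l1 l2 l3 : List Iv) (x y z : ℕ → ℝ) (acc : ℤ × ℤ), l1.length = l2.length → l1.length = l3.length →
    (∀ j : ℕ, j < l1.length → 0 ≤ x j * ((D : ℤ) : ℝ) ∧ x j * ((D : ℤ) : ℝ) ≤ (((getIv l1 j).2 : ℤ) : ℝ)) →
    (∀ j : ℕ, j < l2.length → 0 ≤ y j * ((D : ℤ) : ℝ) ∧ y j * ((D : ℤ) : ℝ) ≤ (((getIv l2 j).2 : ℤ) : ℝ)) →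
    (∀ j : ℕ, j < l3.length → 0 ≤ z j * ((D : ℤ) : ℝ) ∧ z j * ((D : ℤ) : ℝ) ≤ (((getIv l3 j).2 : ℤ) : ℝ)) →
    (acc.2 : ℝ) + (∑ j ∈ range l1.length, x j * y j * z j) * ((D : ℤ) : ℝ) * ((D : ℤ) : ℝ) * ((D : ℤ) : ℝ)
      ≤ (((dotP3 l1 l2 l3 acc).2 : ℤ) : ℝ)
  | [], [], [], x, y, z, acc, _, _, _, _, _ => by simp [dotP3]
  | [], _ :: _, _, x, y, z, acc, h12, _, _, _, _ => by simp at h12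
  | _ :: _, [], _, x, y, z, acc, h12, _, _, _, _ => by simp at h12
  | [], [], _ :: _, x, y, z, acc, _, h13, _, _, _ => by simp at h13
  | _ :: _, _ :: _, [], x, y, z, acc, _, h13, _, _, _ => by simp at h13
  | a :: as, b :: bs, c :: cs, x, y, z, acc, h12, h13, hx, hy, hz => by
      simp only [List.length_cons] at h12 h13 hx hy hz ⊢
      rw [Finset.sum_range_succ', dotP3]
      have h0x := hx 0 (by omega)
      have h0y := hy 0 (by omega)
      have h0z := hz 0 (by omega)
      simp only [getIv, List.getD_cons_zero] at h0x h0y h0z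
      have ih := dotP3_upper as bs cs (fun j => x (j + 1)) (fun j => y (j + 1)) (fun j => z (j + 1))
        (acc.1 + a.1 * b.1 * c.1, acc.2 + a.2 * b.2 * c.2) (by omega) (by omega)
        (fun j hj => by simpa only [getIv, List.getD_cons_succ] using hx (j + 1) (by omega))
        (fun j hj => by simpa only [getIv, List.getD_cons_succ] using hy (j + 1) (by omega))
        (fun j hj => by simpa only [getIv, List.getD_cons_succ] using hz (j + 1) (by omega))
      have hab : x 0 * ((D : ℤ) : ℝ) * (y 0 * ((D : ℤ) : ℝ)) ≤ ((a.2 : ℤ) : ℝ) * ((b.2 : ℤ) : ℝ) :=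
        mul_le_mul h0x.2 h0y.2 h0y.1 (h0x.1.trans h0x.2)
      have hab0 : 0 ≤ x 0 * ((D : ℤ) : ℝ) * (y 0 * ((D : ℤ) : ℝ)) := mul_nonneg h0x.1 h0y.1
      have habc : x 0 * ((D : ℤ) : ℝ) * (y 0 * ((D : ℤ) : ℝ)) * (z 0 * ((D : ℤ) : ℝ))
          ≤ ((a.2 : ℤ) : ℝ) * ((b.2 : ℤ) : ℝ) * ((c.2 : ℤ) : ℝ) :=
        mul_le_mul hab h0z.2 h0z.1 (hab0.trans hab)
      push_cast at ih ⊢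
      nlinarith [ih, habc]

/-! ## Signed weights and rounding -/

/-- ★ a signed weight enclosure times a nonnegative exact-product enclosure (scales multiply). [folklore] -/
theorem smulNN_sound {w X : ℝ} {c : Iv} {x : ℤ × ℤ} (hc : mem w c)
    (hx0 : 0 ≤ (x.1 : ℝ)) (hx1 : (x.1 : ℝ) ≤ X) (hx2 : X ≤ (x.2 : ℝ)) :
    (((smulNN c x).1 : ℤ) : ℝ) ≤ w * ((D : ℤ) : ℝ) * X ∧ w * ((D : ℤ) : ℝ) * X ≤ (((smulNN c x).2 : ℤ) : ℝ) := by
  obtain ⟨hc1, hc2⟩ := hc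
  have hX : 0 ≤ X := hx0.trans hx1
  unfold smulNN
  constructor
  · by_cases h : 0 ≤ c.1
    · rw [if_pos h]; push_cast
      have h' : (0 : ℝ) ≤ (c.1 : ℝ) := by exact_mod_cast h
      nlinarith [mul_le_mul hc1 hx1 hx0 (h'.trans hc1)]
    · rw [if_neg h]; push_cast
      have h' : (c.1 : ℝ) < 0 := by exact_mod_cast (lt_of_not_ge h)
      -- `c.1·x.2 ≤ c.1·X ≤ w D X`
      nlinarith [mul_le_mul_of_nonpos_left hx2 h'.le, mul_le_mul_of_nonneg_right hc1 hX]
  · by_cases h : 0 ≤ c.2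
    · rw [if_pos h]; push_cast
      have h' : (0 : ℝ) ≤ (c.2 : ℝ) := by exact_mod_cast h
      exact mul_le_mul hc2 hx2 hX h'
    · rw [if_neg h]; push_cast
      have h' : (c.2 : ℝ) < 0 := by exact_mod_cast (lt_of_not_ge h)
      have hw : w * ((D : ℤ) : ℝ) ≤ (c.2 : ℝ) := hc2
      -- `w D X ≤ c.2 X`?? no: `w D ≤ c.2 < 0`, `X ≥ x.1 ≥ 0`: `w D X ≤ c.2·x.1`? since `w D ≤ c.2` and `X ≥ x.1`: `w D X ≤ c.2 X ≤ c.2 x.1`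
      nlinarith [mul_le_mul_of_nonneg_right hw hX, mul_le_mul_of_nonpos_left hx1 h'.le]

/-- rounding from scale `D²`. [folklore] -/
theorem mem_roundP' {X : ℝ} {s : ℤ × ℤ}
    (h1 : (s.1 : ℝ) ≤ X * ((D : ℤ) : ℝ) * ((D : ℤ) : ℝ)) (h2 : X * ((D : ℤ) : ℝ) * ((D : ℤ) : ℝ) ≤ (s.2 : ℝ)) :
    mem X (roundP s) := by
  have hD := D_pos
  unfold roundP mem
  constructor
  · have e := ediv_mul_le_real s.1 D D_pos_int
    simp only
    nlinarith
  · have e := le_cdiv_mul_real s.2 D D_pos_int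
    simp only
    nlinarith

/-- rounding from scale `D³`. [folklore] -/
theorem mem_round3 {X : ℝ} {s : ℤ × ℤ}
    (h1 : (s.1 : ℝ) ≤ X * ((D : ℤ) : ℝ) * ((D : ℤ) : ℝ) * ((D : ℤ) : ℝ))
    (h2 : X * ((D : ℤ) : ℝ) * ((D : ℤ) : ℝ) * ((D : ℤ) : ℝ) ≤ (s.2 : ℝ)) :
    mem X (round3 s) := by
  have hD := D_pos
  have hDD : (0 : ℤ) < D * D := mul_pos D_pos_int D_pos_int
  have hDD' : (0 : ℝ) < ((D : ℤ) : ℝ) * ((D : ℤ) : ℝ) := by positivity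
  unfold round3 mem
  constructor
  · have e := ediv_mul_le_real s.1 (D * D) hDD
    push_cast at e
    simp only
    have h3 : (((s.1 / (D * D) : ℤ)) : ℝ) * (((D : ℤ) : ℝ) * ((D : ℤ) : ℝ)) ≤ X * ((D : ℤ) : ℝ) * (((D : ℤ) : ℝ) * ((D : ℤ) : ℝ)) := by
      nlinarith
    exact le_of_mul_le_mul_right h3 hDD'
  · have e := le_cdiv_mul_real s.2 (D * D) hDD
    push_cast at e
    simp only
    have h3 : X * ((D : ℤ) : ℝ) * (((D : ℤ) : ℝ) * ((D : ℤ) : ℝ)) ≤ (((cdiv s.2 (D * D) : ℤ)) : ℝ) * (((D : ℤ) : ℝ) * ((D : ℤ) : ℝ)) := by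
      nlinarith
    exact le_of_mul_le_mul_right h3 hDD'

/-! ## One-sided rounding -/

/-- one-sided rounding from scale `D²`: lower end. [folklore] -/
theorem roundP_fst_le {X : ℝ} {s : ℤ × ℤ} (h1 : (s.1 : ℝ) ≤ X * ((D : ℤ) : ℝ) * ((D : ℤ) : ℝ)) :
    (((roundP s).1 : ℤ) : ℝ) ≤ X * ((D : ℤ) : ℝ) := by
  have hD := D_pos
  have e := ediv_mul_le_real s.1 D D_pos_int
  unfold roundP; simp only
  nlinarith

/-- one-sided rounding from scale `D²`: upper end. [folklore] -/
theorem le_roundP_snd {X : ℝ} {s : ℤ × ℤ} (h2 : X * ((D : ℤ) : ℝ) * ((D : ℤ) : ℝ) ≤ (s.2 : ℝ)) :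
    X * ((D : ℤ) : ℝ) ≤ (((roundP s).2 : ℤ) : ℝ) := by
  have hD := D_pos
  have e := le_cdiv_mul_real s.2 D D_pos_int
  unfold roundP; simp only
  nlinarith

/-- one-sided rounding from scale `D³`: lower end. [folklore] -/
theorem round3_fst_le {X : ℝ} {s : ℤ × ℤ} (h1 : (s.1 : ℝ) ≤ X * ((D : ℤ) : ℝ) * ((D : ℤ) : ℝ) * ((D : ℤ) : ℝ)) :
    (((round3 s).1 : ℤ) : ℝ) ≤ X * ((D : ℤ) : ℝ) := by
  have hD := D_pos
  have hDD : (0 : ℤ) < D * D := mul_pos D_pos_int D_pos_int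
  have hDD' : (0 : ℝ) < ((D : ℤ) : ℝ) * ((D : ℤ) : ℝ) := by positivity
  have e := ediv_mul_le_real s.1 (D * D) hDD
  push_cast at e
  unfold round3; simp only
  have h3 : (((s.1 / (D * D) : ℤ)) : ℝ) * (((D : ℤ) : ℝ) * ((D : ℤ) : ℝ)) ≤ X * ((D : ℤ) : ℝ) * (((D : ℤ) : ℝ) * ((D : ℤ) : ℝ)) := by
    nlinarith
  exact le_of_mul_le_mul_right h3 hDD'

/-- one-sided rounding from scale `D³`: upper end. [folklore] -/
theorem le_round3_snd {X : ℝ} {s : ℤ × ℤ} (h2 : X * ((D : ℤ) : ℝ) * ((D : ℤ) : ℝ) * ((D : ℤ) : ℝ) ≤ (s.2 : ℝ)) :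
    X * ((D : ℤ) : ℝ) ≤ (((round3 s).2 : ℤ) : ℝ) := by
  have hD := D_pos
  have hDD : (0 : ℤ) < D * D := mul_pos D_pos_int D_pos_int
  have hDD' : (0 : ℝ) < ((D : ℤ) : ℝ) * ((D : ℤ) : ℝ) := by positivity
  have e := le_cdiv_mul_real s.2 (D * D) hDD
  push_cast at e
  unfold round3; simp only
  have h3 : X * ((D : ℤ) : ℝ) * (((D : ℤ) : ℝ) * ((D : ℤ) : ℝ)) ≤ (((cdiv s.2 (D * D) : ℤ)) : ℝ) * (((D : ℤ) : ℝ) * ((D : ℤ) : ℝ)) := by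
    nlinarith
  exact le_of_mul_le_mul_right h3 hDD'

end FinXD

end Summit.HubbardSuperconductivity.HubbardSuperconductivity.Theorems.AnisotropyChord.Transfer.Fibre3
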